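import Summits.QuantumFields.BalabanUV.T4Continuum.Support.VariationalColourTowerEnd
import Summits.QuantumFields.BalabanUV.T4Continuum.Support.VariationalColourUpperBoundRel

/-!
# T⁴ programme, spine node NE2 (U1a), lane P2 — SUPPLIER ITEM «V-COL-LOCAL»: THE COLOUR CANONICAL PAIR AND THE COLOUR 0-FORM TOWER END,
# FRAME-FREE — UB⁺-colour RELATIVE to a unitary reference transport `T₀` and P⁺-colour PER UNIT BLOCK, so that the in-block class is carried by
# the REFERENCE (`n·w₀` small, k-uniform) and the ACTUAL site operators `T` only need to be `γ`-close to it (`γ < 1`, NOT small with the level)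
# (the colour ∕ `E`-valued twin of the scalar road's `VariationalCovariantScalarPairLocal.scalar_pair_closed_local` and
# `VariationalCovariantEndLocal.towerLimitRate_scalarTower_closed_local`, p215541; model level; cell `pub-balaban`)

NE2 formalisation swarm `b2b-balaban-t4-ne2-formalise-*`, leaf prover 02 (gen 6); register P2-sup, item «V-COL-LOCAL» (INTENT CLAIMS.log l.17170).
WHY.  Gen 5's closed colour tower END `VariationalColourTowerEnd.towerLimitRate_colourTower_closed` (p224326) carries the ABSOLUTE in-block class
`L^k·w_k ≤ c_w` of the site operators `T k` JOINTLY WITH COMP⁺ (`T (k+1) = compTv (T k) (T′ k)`); by the located finding G-ne2leaf04g2-1 ≡ N-ne2p2g11-2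
that joint hypothesis set is inhabited only by (asymptotically) in-block-flat data — nested composite frames have in-block defect `Θ(c)` across
sub-block faces.  The scalar road's repair (R1)∕(O12) reads UB⁺ RELATIVE to a reference transport `T₀` (small in-block defect `w₀`) with the actual `T`
only `γ`-close to `T₀`, and P⁺ per unit block; both colour relative LEAVES are in the tree (leaf-03-g4's `VariationalColourUpperBoundRel.exists_ubv_rel_eff`
p215137, leaf-02-g4's `VariationalColourPoincarePhys.qWv_le_coarse_rel ∕ qVv_le_composite_rel` p216531).  THIS FILE composes them:
 * §1 **`colour_pair_closed_local`** — gen 5's `VariationalColourScalarPairClosed.colour_pair_closed` (p222739) with UB⁺-colour ↦ `exists_ubv_rel_eff` and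
   P⁺-colour ↦ the relative coercivities; the other three leaves VERBATIM BY NAME (ONE⁺-colour `VariationalColourOneStepPhys.blockSpin_Q1v_le`, REG⁺-colour
   `VariationalColourRegularityRho.hREG_rhov`, FED⁺-colour `VariationalColourScalarPair.Scv_Q1v_le`) and the two ABSTRACT brackets
   (`VariationalCovariantUpperSqrt.fine_ub_of_coarse_sqrt`, `VariationalCovariantAssemblySqrt.pair_bracket_sqrt`).  Binders: target site operators `T`
   UNITARY; REFERENCE `T₀` UNITARY with in-block defect `w₀` (block form), relative operator `‖T x ∘ (T₀ x)⋆ − 1‖ ≤ γ < 1`, per-block smallness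
   `2d(n·w₀)² + 4γ² ≤ ½`, fictitious defect `w′` with `(4 + n·w₀)∕(1−γ) − 1 ≤ n·w′`; one-step ∕ FED⁺ ∕ ONE⁺ ∕ REG⁺ data as in p222739.  Conclusion =
   p222739's `let` telescope VERBATIM at `w := w′` — and `C_P = 136` UNCHANGED (the colour relative coercivity gives `136` directly; the scalar local pair
   weakens to `1088d + 128` only to match its frame-based predecessor).
 * §2 **`towerLimitRate_colourTower_closed_local`** — p224326's END with (`hw`, `hsmall`) ↦ (`T₀ k`, `w₀ k`, `γ`, `hsmall k`, `w′ k`) and the CLASS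
   `L^k·w′_k ≤ c_w′`, through p224326's own `towerLimitRate_colourTower_of_pairs` and its §3 level lemmas BY NAME; conclusion shape VERBATIM:
   `TowerLimitRate (fun _ ↦ 1) 1 (k ↦ effC (L^k) M (Rc k) (T k) b a) (eV Λ⋆ 136 (√d·c_m) + ePV Λ⋆ 136 C_R⋆ c_ε c_δ′) L⁻¹`, `Λ⋆` at `c_w′`.
The instance at leaf-04-g4's operator taxi tower (`T k := nestTv k`, `T₀ k :=` the straight level-`k` taxi) is the sequel `VariationalColourNestedTaxiEnd`.

HONEST FRAMING (T4-DAG p. 1).  MODEL LEVEL: operators `Rc k, R′ k, T k, T₀ k, T′ k`, their defects and the COMP identities are DATA (no identification with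
Bałaban's `U(Γ)` ∕ `R(U)` of [B9] (3.8)–(3.15) — c5, no B0); honest limit «small field PER UNIT BLOCK, k-uniform under the class» exactly as the scalar
road's (O12); [folklore] composition + real arithmetic; nothing printed is a hypothesis; no `def`; no `sorry`; axioms standard.  NE2 NOT proved on either
road; NE3 untouched; spine PROVED 0∕9; rung (B)+1 finite T⁴ — NOT infinite volume, NOT a mass gap, NOT Clay.  HONEST DEPENDENCY (cell, verbatim):
continuum YM on T⁴ ⇐ BetaPertH ∧ nine spine estimates (0/9 proved); BetaPertH ⇐ (D1) ∧ (D4) ∧ CAP+tail; G-an2-4 gates asym, D1 and NE2/3/4.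
-/

noncomputable section

namespace Summit.QuantumFields.BalabanUV.T4Continuum.VariationalColourTowerEndLocal

open Finset
open scoped Matrix
open Literature.MathematicalPhysics.QuantumFieldTheory.Balaban1983to89
open Literature.MathematicalPhysics.QuantumFieldTheory.Balaban1983to89.B5Prop11Plancherel (Tor fine unitVec)
open Literature.MathematicalPhysics.QuantumFieldTheory.Balaban1983to89.B5Block118 (bpt)
open Literature.MathematicalPhysics.QuantumFieldTheory.Balaban1983to89.B5Blocks16 (blockOf)
open Summit.QuantumFields.BalabanUV.T4Continuum.VariationalTransfer (blockSpin)
open Summit.QuantumFields.BalabanUV.T4Continuum.CovariantAveragingTower (TowerLimitRate)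
open Summit.QuantumFields.BalabanUV.T4Continuum.VariationalColourFederbush (dirUv misv norm_le_one_of_mem_unitary)
open Summit.QuantumFields.BalabanUV.T4Continuum.VariationalColourUpperBound (nsqv nsqv_nonneg unitary_data inBlock_of_blockOf exists_ubv_rel_eff)
open Summit.QuantumFields.BalabanUV.T4Continuum.VariationalColourScalarPair
  (Scv Sfv qWv qVv Qkv Q1v Scv_nonneg Sfv_nonneg qWv_nonneg qVv_nonneg norm_sq_le_qWv norm_sq_le_qVv continuous_Qcv continuous_sum_dirUv
   Q1v_surjective Scv_Q1v_le)
open Summit.QuantumFields.BalabanUV.T4Continuum.VariationalColourPoincarePhys (qWv_le_coarse_rel qVv_le_composite_rel)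
open Summit.QuantumFields.BalabanUV.T4Continuum.VariationalColourOneStepPhys (rhov rhov_nonneg blockSpin_Q1v_le)
open Summit.QuantumFields.BalabanUV.T4Continuum.VariationalColourRegularityRho (hREG_rhov Scv_eq)
open Summit.QuantumFields.BalabanUV.T4Continuum.VariationalCovariantAssemblySqrt (pair_bracket_sqrt)
open Summit.QuantumFields.BalabanUV.T4Continuum.VariationalCovariantUpperSqrt (fine_ub_of_coarse_sqrt)
open Summit.QuantumFields.BalabanUV.T4Continuum.VariationalColourTower (compTv Rtrv)
open Summit.QuantumFields.BalabanUV.T4Continuum.VariationalEffectiveHilbertPairs (effC)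
open Summit.QuantumFields.BalabanUV.T4Continuum.VariationalVectorEndOfLeaves (eV ePV eV_nonneg ePV_nonneg eV_level_le ePV_level_le levelV_facts)
open Summit.QuantumFields.BalabanUV.T4Continuum.VariationalColourTowerEnd
  (towerLimitRate_colourTower_of_pairs delta_level_le eps1_level_le deltaP_level_le Lamc_level_le CR_level_le Lam_level_le)

variable {d : ℕ} {E : Type*} [NormedAddCommGroup E] [InnerProductSpace ℂ E] [CompleteSpace E] [FiniteDimensional ℂ E]

/-! ## §1 The colour canonical pair, closed, frame-free -/

section Pair

variable (n L : ℕ) [NeZero n] [NeZero L] (M : Fin d → ℕ) [hM : ∀ μ, NeZero (M μ)]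

omit [NeZero L] [FiniteDimensional ℂ E] in
/-- **UB⁺-colour RELATIVE TO A UNITARY REFERENCE `T₀`, in the colour pair's letters**: leaf-03-g4's `exists_ubv_rel_eff` (p215137) with `S₀ := T₀⋆`, the
reference in-block defect in block form, re-packed at the fictitious defect `w′` (`(4 + n·w₀)∕(1−γ) − 1 ≤ n·w′`):
`∀ ν, ∃ f, Qkv T f = ν ∧ Scv f ≤ 2d·36^d·((1 + n w′)² + 9)·Σ‖ν‖²` — NOTHING on `T` but `‖T x ∘ (T₀ x)⋆ − 1‖ ≤ γ < 1`. [folklore] -/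
theorem hUBc_colour_rel {Rc : Tor (fine n M) → Fin d → (E →L[ℂ] E)} {T T₀ : Tor (fine n M) → (E →L[ℂ] E)}
    (hT₀ : ∀ x, T₀ x ∈ unitary (E →L[ℂ] E)) (hRc : ∀ x μ, Rc x μ ∈ unitary (E →L[ℂ] E)) {w₀ : ℝ} (hw0 : 0 ≤ w₀)
    (hw₀ : ∀ (x : Tor (fine n M)) (μ : Fin d), blockOf n M (x + unitVec (fine n M) μ) = blockOf n M x →
      ‖Rc x μ * star (T₀ (x + unitVec (fine n M) μ)) * T₀ x - 1‖ ≤ w₀)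
    {γ : ℝ} (hγ : γ < 1) (hrel : ∀ x, ‖T x * star (T₀ x) - 1‖ ≤ γ) {w' : ℝ} (hw' : (4 + n * w₀) / (1 - γ) - 1 ≤ n * w') :
    ∀ ν : Tor M → E, ∃ f, Qkv n M T f = ν ∧ Scv n M Rc f ≤ 2 * d * (36 : ℝ) ^ d * ((1 + n * w') ^ 2 + 9) * nsqv ν := by
  intro ν
  obtain ⟨hTS, hT1, hS1⟩ := unitary_data n M hT₀
  obtain ⟨f, hf, hb⟩ := exists_ubv_rel_eff n M (T := T) (T₀ := T₀) (S₀ := fun x => star (T₀ x)) hTS hT1 hS1 (R := Rc)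
    (fun x μ => norm_le_one_of_mem_unitary (hRc x μ)) hw0 (inBlock_of_blockOf n M (T := T₀) (S := fun x => star (T₀ x)) (R := Rc) hw₀)
    hγ hrel hw' ν
  refine ⟨f, hf, ?_⟩
  rw [Scv_eq]
  have e : (n : ℝ) ^ 2 / (n : ℝ) ^ d * ∑ μ, dirUv (fine n M) Rc f μ = ((n : ℝ) ^ d)⁻¹ * ((n : ℝ) ^ 2 * ∑ μ, dirUv (fine n M) Rc f μ) := by
    ring
  rw [e]
  exact hb

/-- **THE COLOUR CANONICAL PAIR, ALL LEAVES DISCHARGED, FRAME-FREE** (UB⁺-colour relative to the unitary reference `T₀`, P⁺-colour per unit block; model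
level; finite-dimensional Hilbert space `E`; only DATA hypotheses remain).  Conclusion = `colour_pair_closed`'s `let` telescope at `w := w′`, `C_P = 136`.
[folklore] -/
theorem colour_pair_closed_local {Rc : Tor (fine n M) → Fin d → (E →L[ℂ] E)} {R' : Tor (fine L (fine n M)) → Fin d → (E →L[ℂ] E)}
    {T T₀ : Tor (fine n M) → (E →L[ℂ] E)} {T' : Tor (fine L (fine n M)) → (E →L[ℂ] E)}
    -- level-n data: UNITARY target site operators and bond operators, plaquette defect `a` (REG⁺)
    (hT : ∀ x, T x ∈ unitary (E →L[ℂ] E)) (hRc : ∀ x μ, Rc x μ ∈ unitary (E →L[ℂ] E))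
    {a : ℝ} (ha : 0 ≤ a)
    (hP : ∀ x μ ν, ‖Rc x μ * Rc (x + unitVec (fine n M) μ) ν - Rc x ν * Rc (x + unitVec (fine n M) ν) μ‖ ≤ a)
    -- the REFERENCE: UNITARY `T₀`, its in-block defect `w₀` (block form), the relative operator `γ < 1`, the per-block smallness, the fictitious `w′`
    (hT₀ : ∀ x, T₀ x ∈ unitary (E →L[ℂ] E)) {w₀ : ℝ} (hw0 : 0 ≤ w₀)
    (hw₀ : ∀ (x : Tor (fine n M)) (μ : Fin d), blockOf n M (x + unitVec (fine n M) μ) = blockOf n M x →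
      ‖Rc x μ * star (T₀ (x + unitVec (fine n M) μ)) * T₀ x - 1‖ ≤ w₀)
    {γ : ℝ} (hγ : γ < 1) (hrel : ∀ x, ‖T x * star (T₀ x) - 1‖ ≤ γ)
    (hsmall : 2 * (d : ℝ) * ((n : ℝ) * w₀) ^ 2 + 4 * γ ^ 2 ≤ 1 / 2)
    {w' : ℝ} (hw'0 : 0 ≤ w') (hw' : (4 + n * w₀) / (1 - γ) - 1 ≤ n * w')
    -- level-nL data: UNITARY one-step site operators, contractive bond operators, in-block defect `w₁` (P⁺ one step up)
    (hT' : ∀ x, T' x ∈ unitary (E →L[ℂ] E)) (hR' : ∀ x μ, ‖R' x μ‖ ≤ 1) {w₁ : ℝ}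
    (hw₁ : ∀ (x : Tor (fine L (fine n M))) (μ : Fin d), blockOf L (fine n M) (x + unitVec (fine L (fine n M)) μ) = blockOf L (fine n M) x →
      ‖R' x μ * star (T' (x + unitVec (fine L (fine n M)) μ)) * T' x - 1‖ ≤ w₁)
    (hsmall₁ : 2 * (d : ℝ) * ((L : ℝ) * w₁) ^ 2 ≤ 1 / 2)
    -- FED⁺ data: one-block transport mismatch `m`
    {m : ℝ} (hm : 0 ≤ m) (hmis : ∀ y μ j, ‖misv L (fine n M) Rc R' T' y μ j‖ ≤ m) (habsorb : 64 * (d : ℝ) * ((n : ℝ) * m) ^ 2 ≤ 1 / 2)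
    -- ONE⁺ data: one-step in-block ∕ crossing defects `m₁` of `(R′, T′, Rc)`
    {m₁ : ℝ} (hm₁ : 0 ≤ m₁)
    (hin : ∀ (y : Tor (fine n M)) (j : Fin d → Fin L) (μ : Fin d), (j μ : ℕ) + 1 < L →
      ‖R' (bpt L (fine n M) y j) μ * star (T' (bpt L (fine n M) y j + unitVec (fine L (fine n M)) μ)) - star (T' (bpt L (fine n M) y j))‖ ≤ m₁)
    (hcross : ∀ (y : Tor (fine n M)) (j : Fin d → Fin L) (μ : Fin d), (j μ : ℕ) + 1 = L →
      ‖R' (bpt L (fine n M) y j) μ * star (T' (bpt L (fine n M) y j + unitVec (fine L (fine n M)) μ))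
        - star (T' (bpt L (fine n M) y j)) * Rc y μ‖ ≤ m₁)
    (μ : Tor M → E) :
    let Λc : ℝ := 2 * d * (36 : ℝ) ^ d * ((1 + n * w') ^ 2 + 9)
    let CP : ℝ := 136
    let CR : ℝ := 2 * Λc + 2 * d * (a * (n : ℝ) ^ 2) + (d : ℝ) ^ 2 * (a * (n : ℝ) ^ 2) ^ 2 * CP
    let ε₁ : ℝ := ((d : ℝ) / 4 + 1 / 2) * ((L : ℝ) / (n : ℝ) ^ 2)
    let δ' : ℝ := Real.sqrt (2 * d * (1 + (d : ℝ) ^ 2)) * ((n : ℝ) * L * m₁)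
    let Λ : ℝ := Λc + (ε₁ * CR + 2 * δ' * Real.sqrt ((1 + ε₁ * CR) * CP) + δ' ^ 2 * CP) * (Λc + 1)
    blockSpin (Qkv n M T) (Scv n M Rc) μ ≤ blockSpin (Qkv n M T ∘ Q1v n L M T') (Sfv n L M R') μ
        + (2 * (Real.sqrt d * ((n : ℝ) * m)) * Real.sqrt (Λ * (CP * (Λ + 1)))
            + (Real.sqrt d * ((n : ℝ) * m)) ^ 2 * (CP * (Λ + 1))) * nsqv μ ∧
      blockSpin (Qkv n M T ∘ Q1v n L M T') (Sfv n L M R') μ ≤ blockSpin (Qkv n M T) (Scv n M Rc) μ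
        + (ε₁ * CR * (Λ + 1) + 2 * δ' * Real.sqrt ((Λ + ε₁ * CR * (Λ + 1)) * (CP * (Λ + 1)))
            + δ' ^ 2 * (CP * (Λ + 1))) * nsqv μ := by
  intro Λc CP CR ε₁ δ' Λ
  have hn0 : (0 : ℝ) < n := by exact_mod_cast Nat.pos_of_ne_zero (NeZero.ne n)
  have hL1 : (1 : ℝ) ≤ L := by exact_mod_cast Nat.one_le_iff_ne_zero.mpr (NeZero.ne L)
  have hd : (0 : ℝ) ≤ d := Nat.cast_nonneg d
  have hΛc : 0 ≤ Λc := by positivity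
  have hCP : 0 ≤ CP := by norm_num
  have hα : 0 ≤ a * (n : ℝ) ^ 2 := by positivity
  have hCR : 0 ≤ CR := by positivity
  have hε₁ : 0 ≤ ε₁ := by positivity
  have hδ' : 0 ≤ δ' := by positivity
  have hetil : 0 ≤ (ε₁ * CR + 2 * δ' * Real.sqrt ((1 + ε₁ * CR) * CP) + δ' ^ 2 * CP) * (Λc + 1) := by positivity
  have hΛ : 0 ≤ Λ := add_nonneg hΛc hetil
  have hδ : 0 ≤ Real.sqrt d * ((n : ℝ) * m) := by positivity
  have hT1 : ∀ x, ‖T' x‖ ≤ 1 := fun x => norm_le_one_of_mem_unitary (hT' x)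
  -- UB⁺-colour at level n RELATIVE TO THE REFERENCE `T₀` (leaf-03-g4), in the pair's letters, at the fictitious `w′`
  have hUBc0 : ∀ ν : Tor M → E, ∃ f, Qkv n M T f = ν ∧ Scv n M Rc f ≤ Λc * nsqv ν :=
    hUBc_colour_rel n M hT₀ hRc hw0 hw₀ hγ hrel hw'
  -- P⁺-colour RELATIVE at both levels (leaf-02-g4), `C_P = 136`
  have hPc : ∀ f, qWv n M f ≤ CP * (Scv n M Rc f + nsqv (Qkv n M T f)) := fun f => qWv_le_coarse_rel n M hT₀ hw₀ hrel hsmall f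
  have hPf : ∀ f', qVv n L M f' ≤ CP * (Sfv n L M R' f' + nsqv (Qkv n M T (Q1v n L M T' f'))) := fun f' =>
    qVv_le_composite_rel n L M hT₀ hw₀ hrel hsmall hT' hw₁ hsmall₁ hR' hm hmis habsorb f'
  -- ONE⁺-colour (leaf-02-g4), square-root shape
  have hONE : ∀ f, blockSpin (Q1v n L M T') (Sfv n L M R') f
      ≤ (Real.sqrt (Scv n M Rc f + ε₁ * rhov n M Rc f) + δ' * Real.sqrt (qWv n M f)) ^ 2 := fun f =>
    blockSpin_Q1v_le n L M hT' hRc hm₁ hin hcross f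
  -- REG⁺-colour (gen 5, file C), for leaf ONE⁺'s `rhov`, fed by the RELATIVE UB⁺ ∕ P⁺
  have hREG : ∀ (ν : Tor M → E) f, Qkv n M T f = ν → (∀ g, Qkv n M T g = ν → Scv n M Rc f ≤ Scv n M Rc g) →
      rhov n M Rc f ≤ CR * (Scv n M Rc f + nsqv ν) := hREG_rhov n M hT hRc ha hP hΛc hUBc0 hPc
  -- FED⁺-colour (leaf-02-g4, inside the pair file)
  have hFED : ∀ f', Scv n M Rc (Q1v n L M T' f')
      ≤ (Real.sqrt (Sfv n L M R' f') + Real.sqrt d * ((n : ℝ) * m) * Real.sqrt (qVv n L M f')) ^ 2 := fun f' =>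
    Scv_Q1v_le n L M hR' hT1 hm hmis f'
  -- the structure hypotheses of the abstract lemmas
  have hnLd : (0 : ℝ) ≤ ((n : ℝ) * L) ^ d := by positivity
  have hnormW : ∀ f : Tor (fine n M) → E, ‖f‖ ^ 2 ≤ ((n : ℝ) * L) ^ d * qWv n M f := by
    intro f
    refine (norm_sq_le_qWv n M f).trans (mul_le_mul_of_nonneg_right ?_ (qWv_nonneg n M f))
    rw [mul_pow]
    exact le_mul_of_one_le_right (by positivity) (one_le_pow₀ hL1)
  have hnormV : ∀ f' : Tor (fine L (fine n M)) → E, ‖f'‖ ^ 2 ≤ ((n : ℝ) * L) ^ d * qVv n L M f' := norm_sq_le_qVv n L M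
  -- UB⁺ one level up from the coarse one, square-root world (leaf-01-g2's ABSTRACT `fine_ub_of_coarse_sqrt`)
  have hUBf : ∀ ν : Tor M → E, ∃ f', Qkv n M T (Q1v n L M T' f') = ν ∧ Sfv n L M R' f' ≤ Λ * nsqv ν := by
    intro ν
    exact fine_ub_of_coarse_sqrt (V := Tor (fine L (fine n M)) → E) (W := Tor (fine n M) → E) (Z := Tor M → E)
      (Qk := Qkv n M T) (Q₁ := Q1v n L M T') (Sc := Scv n M Rc) (Sf := Sfv n L M R') (qW := qWv n M) (qV := qVv n L M) (qZ := nsqv)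
      (ρ := rhov n M Rc) (continuous_Qcv T) (continuous_Qcv T') (continuous_sum_dirUv Rc _) (continuous_sum_dirUv R' _)
      (Q1v_surjective n L M T' hT') (Scv_nonneg n M Rc) (Sfv_nonneg n L M R') (qWv_nonneg n M) (fun μ => nsqv_nonneg μ)
      (rhov_nonneg n M Rc) hnLd hnLd hΛc hCP hCR hε₁ hδ' hnormW hnormV hUBc0 hPc hPf hONE hREG ν
  -- the coarse UB⁺ with the common (larger) constant
  have hUBc : ∀ ν : Tor M → E, ∃ f, Qkv n M T f = ν ∧ Scv n M Rc f ≤ Λ * nsqv ν := by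
    intro ν
    obtain ⟨f, hf, hb⟩ := hUBc0 ν
    exact ⟨f, hf, hb.trans (mul_le_mul_of_nonneg_right (le_add_of_nonneg_right hetil) (nsqv_nonneg ν))⟩
  exact pair_bracket_sqrt (V := Tor (fine L (fine n M)) → E) (W := Tor (fine n M) → E) (Z := Tor M → E)
    (Qk := Qkv n M T) (Q₁ := Q1v n L M T') (Sc := Scv n M Rc) (Sf := Sfv n L M R') (qW := qWv n M) (qV := qVv n L M) (qZ := nsqv)
    (ρ := rhov n M Rc) (continuous_Qcv T) (continuous_Qcv T') (continuous_sum_dirUv Rc _) (continuous_sum_dirUv R' _)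
    (Q1v_surjective n L M T' hT') (Scv_nonneg n M Rc) (Sfv_nonneg n L M R') (qVv_nonneg n L M) (qWv_nonneg n M) (fun μ => nsqv_nonneg μ)
    (rhov_nonneg n M Rc) hnLd hΛ hCP hCR hδ hε₁ hδ' hnormW hnormV hUBc hUBf hPc hPf hFED hONE hREG μ

end Pair

/-! ## §2 The colour 0-form tower, closed, frame-free -/

section Closed

variable (L : ℕ) [NeZero L] (M : Fin d → ℕ) [hM : ∀ μ, NeZero (M μ)] {κ : Type*} [Fintype κ] [DecidableEq κ]
variable (Rc : (k : ℕ) → Tor (fine (L ^ k) M) → Fin d → (E →L[ℂ] E)) (T T₀ : (k : ℕ) → Tor (fine (L ^ k) M) → (E →L[ℂ] E))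
variable (R' : (k : ℕ) → Tor (fine L (fine (L ^ k) M)) → Fin d → (E →L[ℂ] E)) (T' : (k : ℕ) → Tor (fine L (fine (L ^ k) M)) → (E →L[ℂ] E))

/-- **THE COLOUR 0-FORM TOWER, CLOSED, FRAME-FREE — EVERY LEAF DISCHARGED, NO GLOBAL IN-BLOCK CLASS ON THE CARRIERS.**  DATA per level `k` (`n = L^k`):
UNITARY bond operators `Rc k` (plaquette defect `p k`), UNITARY target site operators `T k` (COMP⁺ with the UNITARY one-step `T′ k`), UNITARY REFERENCE
operators `T₀ k` with in-block defect `w₀ k` and relative operator `‖T k x ∘ (T₀ k x)⋆ − 1‖ ≤ γ < 1`, per-block smallness `2d(n·w₀ k)² + 4γ² ≤ ½`, the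
fictitious `w′ k` (`(4 + n·w₀ k)∕(1−γ) − 1 ≤ n·w′ k`), contractive `R′ k` with in-block defect `w₁ k` against `T′ k` (`2d(L·w₁ k)² ≤ ½`), one-block mismatch
`m k` (`64d(n·m k)² ≤ ½`), one-step defects `m₁ k`, the COMP identities; CLASSES `n·w′ k ≤ c_w′`, `p k·n² ≤ c_p`, `n²·m k ≤ c_m`, `n²·m₁ k ≤ c₁`, `2 ≤ L`.
THEN `TowerLimitRate (fun _ ↦ 1) 1 (k ↦ effC (L^k) M (Rc k) (T k) b a) C L⁻¹` on `Tor M × κ`,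
`C = eV Λ⋆ 136 (√d·c_m) + ePV Λ⋆ 136 C_R⋆ ((d∕4+½)L) (√(2d(1+d²))·(L·c₁))`, `Λ⋆` at `c_w′` — p224326's constant VERBATIM.  NO leaf displayed; NO NE3. [folklore] -/
theorem towerLimitRate_colourTower_closed_local (hL : 2 ≤ L)
    (hTcomp : ∀ k, T (k + 1) = compTv (L ^ k) L M (T k) (T' k)) (hRtr : ∀ k, Rc (k + 1) = Rtrv (L ^ k) L M (R' k))
    -- level-`k` coarse data
    (hT : ∀ k x, T k x ∈ unitary (E →L[ℂ] E)) (hRc : ∀ k x μ, Rc k x μ ∈ unitary (E →L[ℂ] E))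
    (p : ℕ → ℝ) (hp : ∀ k, 0 ≤ p k)
    (hP : ∀ k x μ ν, ‖Rc k x μ * Rc k (x + unitVec (fine (L ^ k) M) μ) ν - Rc k x ν * Rc k (x + unitVec (fine (L ^ k) M) ν) μ‖ ≤ p k)
    -- the references
    (hT₀ : ∀ k x, T₀ k x ∈ unitary (E →L[ℂ] E)) (w₀ : ℕ → ℝ) (hw0 : ∀ k, 0 ≤ w₀ k)
    (hw₀ : ∀ k (x : Tor (fine (L ^ k) M)) (μ : Fin d), blockOf (L ^ k) M (x + unitVec (fine (L ^ k) M) μ) = blockOf (L ^ k) M x →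
      ‖Rc k x μ * star (T₀ k (x + unitVec (fine (L ^ k) M) μ)) * T₀ k x - 1‖ ≤ w₀ k)
    {γ : ℝ} (hγ : γ < 1) (hrel : ∀ k x, ‖T k x * star (T₀ k x) - 1‖ ≤ γ)
    (hsmall : ∀ k, 2 * (d : ℝ) * ((((L ^ k : ℕ)) : ℝ) * w₀ k) ^ 2 + 4 * γ ^ 2 ≤ 1 / 2)
    (w' : ℕ → ℝ) (hw'0 : ∀ k, 0 ≤ w' k) (hw' : ∀ k, (4 + (((L ^ k : ℕ)) : ℝ) * w₀ k) / (1 - γ) - 1 ≤ (((L ^ k : ℕ)) : ℝ) * w' k)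
    -- level-`k` one-step data
    (hT' : ∀ k x, T' k x ∈ unitary (E →L[ℂ] E)) (hR' : ∀ k x μ, ‖R' k x μ‖ ≤ 1) (w₁ : ℕ → ℝ)
    (hw₁ : ∀ k (x : Tor (fine L (fine (L ^ k) M))) (μ : Fin d),
      blockOf L (fine (L ^ k) M) (x + unitVec (fine L (fine (L ^ k) M)) μ) = blockOf L (fine (L ^ k) M) x →
      ‖R' k x μ * star (T' k (x + unitVec (fine L (fine (L ^ k) M)) μ)) * T' k x - 1‖ ≤ w₁ k)
    (hsmall₁ : ∀ k, 2 * (d : ℝ) * ((L : ℝ) * w₁ k) ^ 2 ≤ 1 / 2)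
    (m : ℕ → ℝ) (hm : ∀ k, 0 ≤ m k) (hmis : ∀ k y μ j, ‖misv L (fine (L ^ k) M) (Rc k) (R' k) (T' k) y μ j‖ ≤ m k)
    (habsorb : ∀ k, 64 * (d : ℝ) * ((((L ^ k : ℕ)) : ℝ) * m k) ^ 2 ≤ 1 / 2)
    (m₁ : ℕ → ℝ) (hm₁ : ∀ k, 0 ≤ m₁ k)
    (hin : ∀ k (y : Tor (fine (L ^ k) M)) (j : Fin d → Fin L) (μ : Fin d), (j μ : ℕ) + 1 < L →
      ‖R' k (bpt L (fine (L ^ k) M) y j) μ * star (T' k (bpt L (fine (L ^ k) M) y j + unitVec (fine L (fine (L ^ k) M)) μ))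
        - star (T' k (bpt L (fine (L ^ k) M) y j))‖ ≤ m₁ k)
    (hcross : ∀ k (y : Tor (fine (L ^ k) M)) (j : Fin d → Fin L) (μ : Fin d), (j μ : ℕ) + 1 = L →
      ‖R' k (bpt L (fine (L ^ k) M) y j) μ * star (T' k (bpt L (fine (L ^ k) M) y j + unitVec (fine L (fine (L ^ k) M)) μ))
        - star (T' k (bpt L (fine (L ^ k) M) y j)) * Rc k y μ‖ ≤ m₁ k)
    -- the classes
    {cw cp cm c₁ : ℝ} (hcw : ∀ k, (((L ^ k : ℕ)) : ℝ) * w' k ≤ cw) (hcp : ∀ k, p k * (((L ^ k : ℕ)) : ℝ) ^ 2 ≤ cp)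
    (hcm : ∀ k, (((L ^ k : ℕ)) : ℝ) ^ 2 * m k ≤ cm) (hc₁ : ∀ k, (((L ^ k : ℕ)) : ℝ) ^ 2 * m₁ k ≤ c₁)
    (b : OrthonormalBasis κ ℂ E) {a : ℝ} (ha : 0 < a) :
    let Λcs : ℝ := 2 * d * (36 : ℝ) ^ d * ((1 + cw) ^ 2 + 9)
    let CRs : ℝ := 2 * Λcs + 2 * d * cp + (d : ℝ) ^ 2 * cp ^ 2 * 136
    let cε : ℝ := ((d : ℝ) / 4 + 1 / 2) * L
    let cδ' : ℝ := Real.sqrt (2 * d * (1 + (d : ℝ) ^ 2)) * ((L : ℝ) * c₁)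
    let Λs : ℝ := Λcs + (cε * CRs + 2 * cδ' * Real.sqrt ((1 + cε * CRs) * 136) + cδ' ^ 2 * 136) * (Λcs + 1)
    TowerLimitRate (ι := fun _ => Tor M × κ) (fun _ => (1 : Matrix (Tor M × κ) (Tor M × κ) ℂ)) 1
      (fun k => effC (L ^ k) M (Rc k) (T k) b a) (eV Λs 136 (Real.sqrt d * cm) + ePV Λs 136 CRs cε cδ') ((L : ℝ)⁻¹) := by
  intro Λcs CRs cε cδ' Λs
  have hL1 : (1 : ℝ) ≤ L := by exact_mod_cast (show 1 ≤ L by omega)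
  have hL0 : (0 : ℝ) < L := by linarith
  have hθ0 : (0 : ℝ) ≤ (L : ℝ)⁻¹ := by positivity
  have hθ1 : ((L : ℝ)⁻¹) < 1 := inv_lt_one_of_one_lt₀ (by exact_mod_cast (show 1 < L by omega))
  have hθ1' : ((L : ℝ)⁻¹) ≤ 1 := hθ1.le
  have hd : (0 : ℝ) ≤ d := Nat.cast_nonneg d
  -- the level constants of `colour_pair_closed_local` at `n = L^k` (UB⁺ at the fictitious defect `w′ k`)
  let nk : ℕ → ℝ := fun k => (((L ^ k : ℕ)) : ℝ)
  let Λc : ℕ → ℝ := fun k => 2 * d * (36 : ℝ) ^ d * ((1 + nk k * w' k) ^ 2 + 9)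
  let CR : ℕ → ℝ := fun k => 2 * Λc k + 2 * d * (p k * nk k ^ 2) + (d : ℝ) ^ 2 * (p k * nk k ^ 2) ^ 2 * 136
  let ε₁ : ℕ → ℝ := fun k => ((d : ℝ) / 4 + 1 / 2) * ((L : ℝ) / nk k ^ 2)
  let δ' : ℕ → ℝ := fun k => Real.sqrt (2 * d * (1 + (d : ℝ) ^ 2)) * (nk k * L * m₁ k)
  let Λ : ℕ → ℝ := fun k => Λc k + (ε₁ k * CR k + 2 * δ' k * Real.sqrt ((1 + ε₁ k * CR k) * 136) + δ' k ^ 2 * 136) * (Λc k + 1)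
  let δ : ℕ → ℝ := fun k => Real.sqrt d * (nk k * m k)
  -- class facts per level
  have hnk0 : ∀ k, 0 ≤ nk k := fun k => by positivity
  have hx : ∀ k, 0 ≤ nk k * w' k := fun k => mul_nonneg (hnk0 k) (hw'0 k)
  have hcw0 : 0 ≤ cw := (hx 0).trans (hcw 0)
  have hα0 : ∀ k, 0 ≤ p k * nk k ^ 2 := fun k => by have := hp k; positivity
  have hcp0 : 0 ≤ cp := (hα0 0).trans (hcp 0)
  have hΛc0 : ∀ k, 0 ≤ Λc k := fun k => by have := hx k; positivity
  have hΛcs : ∀ k, Λc k ≤ Λcs := fun k => Lamc_level_le (hx k) (hcw k)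
  have hΛcs0 : 0 ≤ Λcs := (hΛc0 0).trans (hΛcs 0)
  have hCR0 : ∀ k, 0 ≤ CR k := fun k => by have := hΛc0 k; have := hα0 k; positivity
  have hCRs : ∀ k, CR k ≤ CRs := fun k => CR_level_le (hΛcs k) (hα0 k) (hcp k)
  have hCRs0 : 0 ≤ CRs := (hCR0 0).trans (hCRs 0)
  have hε0 : ∀ k, 0 ≤ ε₁ k := fun k => by have := hnk0 k; positivity
  have hεθ : ∀ k, ε₁ k ≤ cε * ((L : ℝ)⁻¹) ^ k := fun k => eps1_level_le L hL1 k
  have hcε0 : 0 ≤ cε := by positivity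
  have hε1 : ∀ k, ε₁ k ≤ cε := fun k => (hεθ k).trans (mul_le_of_le_one_right hcε0 (pow_le_one₀ hθ0 hθ1'))
  have hδ'0 : ∀ k, 0 ≤ δ' k := fun k => by have := hnk0 k; have := hm₁ k; positivity
  have hδ'θ : ∀ k, δ' k ≤ cδ' * ((L : ℝ)⁻¹) ^ k := fun k => deltaP_level_le L hL1 k (hc₁ k)
  have hcδ'0 : 0 ≤ cδ' := (hδ'0 0).trans (by simpa using hδ'θ 0)
  have hδ'1 : ∀ k, δ' k ≤ cδ' := fun k => (hδ'θ k).trans (mul_le_of_le_one_right hcδ'0 (pow_le_one₀ hθ0 hθ1'))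
  have hΛ0 : ∀ k, 0 ≤ Λ k := fun k => by
    have := hΛc0 k; have := hCR0 k; have := hε0 k; have := hδ'0 k; positivity
  have hΛs : ∀ k, Λ k ≤ Λs := fun k => Lam_level_le (hΛc0 k) (hΛcs k) (hCR0 k) (hCRs k) (hε0 k) (hε1 k) (hδ'0 k) (hδ'1 k)
  have hδ0 : ∀ k, 0 ≤ δ k := fun k => by have := hnk0 k; have := hm k; positivity
  have hδθ : ∀ k, δ k ≤ Real.sqrt d * cm * ((L : ℝ)⁻¹) ^ k := fun k => delta_level_le L hL1 k (hcm k)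
  have hcm0 : 0 ≤ Real.sqrt d * cm := (hδ0 0).trans (by simpa using hδθ 0)
  -- the per-level defects and their rates
  have hE0 : 0 ≤ eV Λs 136 (Real.sqrt d * cm) := eV_nonneg ((hΛ0 0).trans (hΛs 0)) (by norm_num) hcm0
  have hEP0 : 0 ≤ ePV Λs 136 CRs cε cδ' := ePV_nonneg ((hΛ0 0).trans (hΛs 0)) (by norm_num) hCRs0 hcε0 hcδ'0
  have hC : 0 ≤ eV Λs 136 (Real.sqrt d * cm) + ePV Λs 136 CRs cε cδ' := add_nonneg hE0 hEP0
  have he : ∀ k, eV (Λ k) 136 (δ k) ≤ (eV Λs 136 (Real.sqrt d * cm) + ePV Λs 136 CRs cε cδ') * ((L : ℝ)⁻¹) ^ k := fun k => by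
    have h1 := eV_level_le k (hΛ0 k) (hΛs k) (by norm_num : (0 : ℝ) ≤ 136) le_rfl (hδ0 k) hθ0 hθ1' (hδθ k)
    have h2 : 0 ≤ ePV Λs 136 CRs cε cδ' * ((L : ℝ)⁻¹) ^ k := mul_nonneg hEP0 (pow_nonneg hθ0 k)
    linarith [add_mul (eV Λs 136 (Real.sqrt d * cm)) (ePV Λs 136 CRs cε cδ') (((L : ℝ)⁻¹) ^ k)]
  have he' : ∀ k, ePV (Λ k) 136 (CR k) (ε₁ k) (δ' k) ≤ (eV Λs 136 (Real.sqrt d * cm) + ePV Λs 136 CRs cε cδ') * ((L : ℝ)⁻¹) ^ k := fun k => by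
    have h1 := ePV_level_le k (hΛ0 k) (hΛs k) (by norm_num : (0 : ℝ) ≤ 136) le_rfl (hCR0 k) (hCRs k) (hε0 k) hcε0 (hδ'0 k) hcδ'0
      hθ0 hθ1' (hεθ k) (hδ'θ k)
    have h2 : 0 ≤ eV Λs 136 (Real.sqrt d * cm) * ((L : ℝ)⁻¹) ^ k := mul_nonneg hE0 (pow_nonneg hθ0 k)
    linarith [add_mul (eV Λs 136 (Real.sqrt d * cm)) (ePV Λs 136 CRs cε cδ') (((L : ℝ)⁻¹) ^ k)]
  -- the colour pair, closed and frame-free, at every level, fed to the pair-to-rate currency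
  refine towerLimitRate_colourTower_of_pairs L M Rc T R' T' hT (CP := fun _ => 136)
    (fun k f => qWv_le_coarse_rel (L ^ k) M (hT₀ k) (hw₀ k) (hrel k) (hsmall k) f) hTcomp hRtr b ha hC hθ0 hθ1
    (fun k => eV (Λ k) 136 (δ k)) (fun k => ePV (Λ k) 136 (CR k) (ε₁ k) (δ' k)) he he' fun k μ => ?_
  exact colour_pair_closed_local (L ^ k) L M (hT k) (hRc k) (hp k) (hP k) (hT₀ k) (hw0 k) (hw₀ k) hγ (hrel k) (hsmall k) (hw'0 k) (hw' k)
    (hT' k) (hR' k) (hw₁ k) (hsmall₁ k) (hm k) (hmis k) (habsorb k) (hm₁ k) (hin k) (hcross k) μ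

end Closed

end Summit.QuantumFields.BalabanUV.T4Continuum.VariationalColourTowerEndLocal

end
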